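import Summits.AtomisticToContinuum.Crystallization.Theorems.OverbindingBudgetCorefreeBridgeChartSep

/-!
# `OverbindingBudget` / crux `RobustDefectLimitWindows` — door half B under the item's RECURRENCE binder (v8b)

Route `OverbindingBudget` (sub-problem `Crystallization`), crux `RobustDefectLimitWindows`
(item `stmt-AtomisticToContinuum-31280`), skeleton «HostedDustCut», door half B `stub_corefreeRigidity`,
helper-level sub-line `CorefreeRigidity` (lineage `decomp-a2c-lens-4`, g16).

The v8 AMENDMENT (critic `decomp-a2c-crit-1`, CRITIC-LEDGER row 194: «ADMISSIBLE and ENDORSED for the v8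
bundle») gives the two door stubs of «HostedDustCut» the ITEM's own two-way uniform-recurrence hypothesis
(`REC` below, verbatim the binder of `Theses.OverbindingBudget.RobustDefectLimitWindows`), which the v7 text had
dropped; the banked candidate «v8b» carries it.  Under recurrence the global pieces of half B weaken:

* `LargeScaleRegularityRec` = B-large with `REC Y` (loses the isolated-twin scenario);
* `StackingSelectionRec` = B-stack with `REC Y` — S–M instead of L: μ-GSC ⇒ bulk energy density `≤ e⋆`;
  `GlobalBarlowMatch` + recurrence ⇒ repetitive stacking word; a certified stacking-energy gap per non-alternating
  letter ⇒ zero density of non-hcp letters ⇒ (repetitive) none — no Shockley-partial-loop competitor needed.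

This file types the two recurrent pieces, records that they are WEAKER than the v7 pieces, and glues door half B
in the v8b currency: `stub_corefreeRigidity_v8b_of_pieces : CorefreeChartSep → LargeScaleRegularityRec →
StackingSelectionRec → HcpLiouville → PhononStability → ‹v8b text of stub_corefreeRigidity›` (force balance = the
proved `muGSCForceBalance`).  Nothing here is registered; v7 stays the skeleton of record until the v8 bundle.
-/

noncomputable section

namespace Summit.AtomisticToContinuum.Crystallization.Theorems.OverbindingBudgetCorefreeBridge

open Literature.MathematicalPhysics.StatisticalMechanics (UniformlyDiscrete lennardJones IsMuGSC)
open Summit.AtomisticToContinuum.Crystallization.Theorems.OverbindingBudgetWallTensionLever (MAT)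
open Summit.AtomisticToContinuum.Crystallization.Theorems.OverbindingBudgetViolatorDensityFloor (GT)

/-- `REC Y` — the ITEM's two-way uniform recurrence (verbatim the binder of `RobustDefectLimitWindows`): every
`R`-patch of `Y` reappears, `ε`-closely and two-way, within distance `L(R, ε)` of every site. -/
def REC (Y : Set E3) : Prop :=
  ∀ R ε : ℝ, 0 < ε → ∃ L : ℝ, ∀ p ∈ Y, ∀ q ∈ Y, ∃ q' ∈ Y, dist q' q ≤ L ∧
    (∀ y ∈ Y, dist y p ≤ R → ∃ y' ∈ Y, dist (y' - q') (y - p) ≤ ε) ∧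
    (∀ y' ∈ Y, dist y' q' ≤ R → ∃ y ∈ Y, dist (y' - q') (y - p) ≤ ε)

/-- **B-large under recurrence**: `LargeScaleRegularity` with the extra hypothesis `REC Y`. -/
def LargeScaleRegularityRec : Prop :=
  ∀ e : ℝ, TEND e → LB e → ∀ Y : Set E3, UniformlyDiscrete Y → IsMuGSC lennardJones e Y → REC Y → COV Y →
    ∀ a : ℝ, 47 / 50 ≤ a → a ≤ 1 → MAT a Y → Corefree a Y → Developable (1 / 5) a Y →
      GlobalBarlowMatch (1 / 40) Y

/-- **B-stack under recurrence** (S–M): `StackingSelection` with the extra hypothesis `REC Y`. -/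
def StackingSelectionRec : Prop :=
  ∀ e : ℝ, TEND e → LB e → ∀ Y : Set E3, UniformlyDiscrete Y → IsMuGSC lennardJones e Y → REC Y →
    GlobalBarlowMatch (1 / 40) Y → GlobalHcpMatch Y

/-- The recurrent B-large is weaker than B-large. [folklore] -/
theorem largeScaleRegularityRec_of (h : LargeScaleRegularity) : LargeScaleRegularityRec :=
  fun e hT hLB Y hUD hμ _hrec hcov a ha1 ha2 hMAT hcore hdev =>
    h e hT hLB Y hUD hμ hcov a ha1 ha2 hMAT hcore hdev

/-- The recurrent B-stack is weaker than B-stack. [folklore] -/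
theorem stackingSelectionRec_of (h : StackingSelection) : StackingSelectionRec :=
  fun e hT hLB Y hUD hμ _hrec hGB => h e hT hLB Y hUD hμ hGB

/-- **Door half B under recurrence from HB1′ + recurrent B-large + recurrent B-stack + 9332 + 9333.** -/
theorem corefreeRigidity_rec_of_pieces (hC : CorefreeChartSep) (hL : LargeScaleRegularityRec)
    (hS : StackingSelectionRec)
    (h9332 : Summit.AtomisticToContinuum.Crystallization.Theses.ExcessDecayLiouville.HcpLiouville)
    (h9333 : Summit.AtomisticToContinuum.Crystallization.Theses.ExcessDecayLiouville.PhononStability) :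
    ∀ e : ℝ, TEND e → LB e → ∀ Y : Set E3, UniformlyDiscrete Y → IsMuGSC lennardJones e Y → REC Y → COV Y →
      ∀ a : ℝ, 47 / 50 ≤ a → a ≤ 1 → ∀ D : ℝ, 0 ≤ D → D ≤ 13 → SEP a D Y → MAT a Y → Corefree a Y →
        ∀ y ∈ Y, GT a Y y := by
  intro e hT hLB Y hUD hμ hrec hcov a ha1 ha2 D hD0 hD13 hsep hMAT hcore y hy
  have hchart : Developable (1 / 5) a Y := hC Y hUD hcov a ha1 ha2 D hD0 hD13 hsep hMAT hcore
  have hGB : GlobalBarlowMatch (1 / 40) Y :=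
    hL e hT hLB Y hUD hμ hrec hcov a ha1 ha2 hMAT hcore hchart
  obtain ⟨t, A, hA, hI, hNear⟩ := hS e hT hLB Y hUD hμ hrec hGB
  have hEq : Equil Y := muGSCForceBalance e Y hUD hμ
  obtain ⟨q, hq, hclean⟩ := exists_clean_of_sep_cov hD0 hcov hsep hy
  obtain ⟨δ, hδ, hsepδ⟩ := hUD
  obtain ⟨t', A', _hA', hYeq⟩ := h9332 h9333 δ hδ Y hsepδ hEq t A hA hI hNear
  have hYS : Y = Sites t' A' := hYeq
  subst hYS
  exact sites_homogeneous hq hy hclean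

/-- The same against the v8b text of `stub_corefreeRigidity` (banked candidate «v8b», sha256 2a3ad153…: the v7
text with the item's recurrence binder inserted after `IsMuGSC`; byte-identical). -/
theorem stub_corefreeRigidity_v8b_of_pieces (hC : CorefreeChartSep) (hL : LargeScaleRegularityRec)
    (hS : StackingSelectionRec)
    (h9332 : Summit.AtomisticToContinuum.Crystallization.Theses.ExcessDecayLiouville.HcpLiouville)
    (h9333 : Summit.AtomisticToContinuum.Crystallization.Theses.ExcessDecayLiouville.PhononStability) :
    ∀ e : ℝ, Filter.Tendsto (fun N : ℕ => Literature.MathematicalPhysics.StatisticalMechanics.groundStateEnergy Literature.MathematicalPhysics.StatisticalMechanics.lennardJones 3 N / N) Filter.atTop (nhds e) → (∀ N : ℕ, 0 < N → e ≤ Literature.MathematicalPhysics.StatisticalMechanics.groundStateEnergy Literature.MathematicalPhysics.StatisticalMechanics.lennardJones 3 N / N) → ∀ Y : Set (EuclideanSpace ℝ (Fin 3)), Literature.MathematicalPhysics.StatisticalMechanics.UniformlyDiscrete Y → Literature.MathematicalPhysics.StatisticalMechanics.IsMuGSC Literature.MathematicalPhysics.StatisticalMechanics.lennardJones e Y → (∀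 R ε : ℝ, 0 < ε → ∃ L : ℝ, ∀ p ∈ Y, ∀ q ∈ Y, ∃ q' ∈ Y, dist q' q ≤ L ∧ (∀ y ∈ Y, dist y p ≤ R → ∃ y' ∈ Y, dist (y' - q') (y - p) ≤ ε) ∧ (∀ y' ∈ Y, dist y' q' ≤ R → ∃ y ∈ Y, dist (y' - q') (y - p) ≤ ε)) → (∀ z : EuclideanSpace ℝ (Fin 3), ∃ w ∈ Y, dist z w < 9 / 10) → ∀ a : ℝ, 47 / 50 ≤ a → a ≤ 1 → ∀ D : ℝ, 0 ≤ D → D ≤ 13 → (∀ p ∈ Y, ∀ q ∈ Y, ¬ ({w ∈ Y | w ≠ p ∧ dist p w ≤ a * (1 + 1 / 50)}.ncard = 12 ∧ ∀ w ∈ Y, w ≠ p → a * (1 - 1 / 50) ≤ dist p w ∧ (dist p w ≤ a * (1 + 1 / 50) ∨ a * (63 / 50) ≤ dist p w)) → ¬ ({w ∈ Y | w ≠ q ∧ dist q w ≤ a * (1 + 1 / 50)}.ncard = 12 ∧ ∀ w ∈ Y, w ≠ q → a * (1 - 1 / 50) ≤ dist q w ∧ (dist q w ≤ a * (1 + 1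 / 50) ∨ a * (63 / 50) ≤ dist q w)) → (dist p q ≤ D ∨ 2 * D + 6 ≤ dist p q)) → (∀ y ∈ Y, ({w ∈ Y | w ≠ y ∧ dist y w ≤ a * (1 + 1 / 50)}.ncard = 12 ∧ ∀ w ∈ Y, w ≠ y → a * (1 - 1 / 50) ≤ dist y w ∧ (dist y w ≤ a * (1 + 1 / 50) ∨ a * (63 / 50) ≤ dist y w)) → (∃ T : Finset (EuclideanSpace ℝ (Fin 3)), (↑T : Set (EuclideanSpace ℝ (Fin 3))) = (fun w => a⁻¹ • (w - y)) '' {w ∈ Y | w ≠ y ∧ dist y w ≤ a * (1 + 1 / 50)} ∧ (Literature.Geometry.DiscreteGeometry.ShellCloseTo (1 / 5) T Literature.Geometry.DiscreteGeometry.fccKissingPattern ∨ Literature.Geometry.DiscreteGeometry.ShellCloseTo (1 / 5) T Literature.Geometry.DiscreteGeometry.hcpKissingPattern))) → (∀ y ∈ Y, ¬ ¬ (({v ∈ Y | v ≠ y ∧ dist y v ≤ a * (1 + 1 / 10)}.ncard = 12 ∧ ∀ v ∈ Y, v ≠ y → a * (1 - 1 / 10) ≤ dist y v ∧ (dist y v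 ≤ a * (1 + 1 / 10) ∨ a * (63 / 50) ≤ dist y v)) ∧ (∃ T : Finset (EuclideanSpace ℝ (Fin 3)), (↑T : Set (EuclideanSpace ℝ (Fin 3))) = (fun v => a⁻¹ • (v - y)) '' {v ∈ Y | v ≠ y ∧ dist y v ≤ a * (1 + 1 / 10)} ∧ (Literature.Geometry.DiscreteGeometry.ShellCloseTo (2 / 5) T Literature.Geometry.DiscreteGeometry.fccKissingPattern ∨ Literature.Geometry.DiscreteGeometry.ShellCloseTo (2 / 5) T Literature.Geometry.DiscreteGeometry.hcpKissingPattern)))) → ∀ y ∈ Y, ({w ∈ Y | w ≠ y ∧ dist y w ≤ a * (1 + 1 / 50)}.ncard = 12 ∧ ∀ w ∈ Y, w ≠ y → a * (1 - 1 / 50) ≤ dist y w ∧ (dist y w ≤ a * (1 + 1 / 50) ∨ a * (63 / 50) ≤ dist y w)) := by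
  intro e hT hLB Y hUD hμ hrec hcov a ha1 ha2 D hD0 hD13 hsep hMAT hcore
  exact corefreeRigidity_rec_of_pieces hC hL hS h9332 h9333 e hT hLB Y hUD hμ hrec hcov a ha1 ha2 D hD0 hD13
    hsep hMAT hcore

/-- … and, a fortiori, from the v7 pieces (B-large, B-stack without recurrence). -/
theorem stub_corefreeRigidity_v8b_of_v7_pieces (hC : CorefreeChartSep) (hL : LargeScaleRegularity)
    (hS : StackingSelection)
    (h9332 : Summit.AtomisticToContinuum.Crystallization.Theses.ExcessDecayLiouville.HcpLiouville)
    (h9333 : Summit.AtomisticToContinuum.Crystallization.Theses.ExcessDecayLiouville.PhononStability) :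
    ∀ e : ℝ, Filter.Tendsto (fun N : ℕ => Literature.MathematicalPhysics.StatisticalMechanics.groundStateEnergy Literature.MathematicalPhysics.StatisticalMechanics.lennardJones 3 N / N) Filter.atTop (nhds e) → (∀ N : ℕ, 0 < N → e ≤ Literature.MathematicalPhysics.StatisticalMechanics.groundStateEnergy Literature.MathematicalPhysics.StatisticalMechanics.lennardJones 3 N / N) → ∀ Y : Set (EuclideanSpace ℝ (Fin 3)), Literature.MathematicalPhysics.StatisticalMechanics.UniformlyDiscrete Y → Literature.MathematicalPhysics.StatisticalMechanics.IsMuGSC Literature.MathematicalPhysics.StatisticalMechanics.lennardJones e Y → (∀ R ε : ℝ, 0 < ε → ∃ L : ℝ, ∀ p ∈ Y, ∀ q ∈ Y, ∃ q' ∈ Y, dist q' q ≤ L ∧ (∀ y ∈ Y, dist y p ≤ R → ∃ y' ∈ Y, dist (y' - q') (y - p) ≤ ε) ∧ (∀ y' ∈ Y, dist y' q' ≤ R → ∃ y ∈ Y, dist (y' - q') (y - p) ≤ ε)) → (∀ z : EuclideanSpace ℝ (Fin 3), ∃ w ∈ Y, dist z w < 9 / 10) → ∀ a : ℝ, 47 /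 50 ≤ a → a ≤ 1 → ∀ D : ℝ, 0 ≤ D → D ≤ 13 → (∀ p ∈ Y, ∀ q ∈ Y, ¬ ({w ∈ Y | w ≠ p ∧ dist p w ≤ a * (1 + 1 / 50)}.ncard = 12 ∧ ∀ w ∈ Y, w ≠ p → a * (1 - 1 / 50) ≤ dist p w ∧ (dist p w ≤ a * (1 + 1 / 50) ∨ a * (63 / 50) ≤ dist p w)) → ¬ ({w ∈ Y | w ≠ q ∧ dist q w ≤ a * (1 + 1 / 50)}.ncard = 12 ∧ ∀ w ∈ Y, w ≠ q → a * (1 - 1 / 50) ≤ dist q w ∧ (dist q w ≤ a * (1 + 1 / 50) ∨ a * (63 / 50) ≤ dist q w)) → (dist p q ≤ D ∨ 2 * D + 6 ≤ dist p q)) → (∀ y ∈ Y, ({w ∈ Y | w ≠ y ∧ dist y w ≤ a * (1 + 1 / 50)}.ncard = 12 ∧ ∀ w ∈ Y, w ≠ y → a * (1 - 1 / 50) ≤ dist y w ∧ (dist y w ≤ a * (1 + 1 / 50) ∨ a * (63 / 50) ≤ dist y w)) → (∃ T : Finset (EuclideanSpace ℝ (Fin 3)), (↑T : Set (EuclideanSpace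 ℝ (Fin 3))) = (fun w => a⁻¹ • (w - y)) '' {w ∈ Y | w ≠ y ∧ dist y w ≤ a * (1 + 1 / 50)} ∧ (Literature.Geometry.DiscreteGeometry.ShellCloseTo (1 / 5) T Literature.Geometry.DiscreteGeometry.fccKissingPattern ∨ Literature.Geometry.DiscreteGeometry.ShellCloseTo (1 / 5) T Literature.Geometry.DiscreteGeometry.hcpKissingPattern))) → (∀ y ∈ Y, ¬ ¬ (({v ∈ Y | v ≠ y ∧ dist y v ≤ a * (1 + 1 / 10)}.ncard = 12 ∧ ∀ v ∈ Y, v ≠ y → a * (1 - 1 / 10) ≤ dist y v ∧ (dist y v ≤ a * (1 + 1 / 10) ∨ a * (63 / 50) ≤ dist y v)) ∧ (∃ T : Finset (EuclideanSpace ℝ (Fin 3)), (↑T : Set (EuclideanSpace ℝ (Fin 3))) = (fun v => a⁻¹ • (v - y)) '' {v ∈ Y | v ≠ y ∧ dist y v ≤ a * (1 + 1 / 10)} ∧ (Literature.Geometry.DiscreteGeometry.ShellCloseTo (2 / 5) T Literature.Geometry.DiscreteGeometry.fccKissingPattern ∨ Literature.Geometry.DiscreteGeometry.ShellCloseTo (2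 / 5) T Literature.Geometry.DiscreteGeometry.hcpKissingPattern)))) → ∀ y ∈ Y, ({w ∈ Y | w ≠ y ∧ dist y w ≤ a * (1 + 1 / 50)}.ncard = 12 ∧ ∀ w ∈ Y, w ≠ y → a * (1 - 1 / 50) ≤ dist y w ∧ (dist y w ≤ a * (1 + 1 / 50) ∨ a * (63 / 50) ≤ dist y w)) :=
  stub_corefreeRigidity_v8b_of_pieces hC (largeScaleRegularityRec_of hL) (stackingSelectionRec_of hS) h9332 h9333

end Summit.AtomisticToContinuum.Crystallization.Theorems.OverbindingBudgetCorefreeBridge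

end
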